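import Summits.KontsevichZagierPeriods.KontsevichZagierPeriods.Theorems.SoloInformedCurveSectorPoly

/-!
# The Jacobian criterion for the curve sector (Theorem XVI-J)

Solo programme `solo-KontsevichZagierPeriods-informed`, session s32, line "the curve sector".
The conceptual statement behind Theorems XVI-P (`SoloInformedCurveSectorPoly.lean`, polynomial
weights) and XVI-Q (`SoloInformedCurveSectorRational.lean`, weights `q(x, y) / d(y)`):

* `soloInformed_per_mem_span_of_jacobian` — **THEOREM XVI-J.** A weighted planar integral
  `[D, w]` whose weight is, on `D`, the absolute Jacobian `|det Φ'|` of an injective `ℚ`-semialgebraic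
  map `Φ` differentiable within `D` and with bounded image, lies in the curve sector
  `soloInformedKappaSpan`: rule (2) of [KZ 2001, §1.2] gives `[D, |det Φ'|] ≡ [Φ(D), 1]`, the area
  of a bounded planar `ℚ`-semialgebraic set (`soloInformed_per_mem_span_planar_of_isBounded`).
  In the language of forms: `w dx ∧ dy = Φ^*(du ∧ dv)` with `Φ` Nash. Theorems XVI-P/XVI-Q are the
  instances `Φ = (x, P(x, y))` (`∂P/∂y = p + M`) and `Φ = Θ⁻¹ ∘ shear`.
* `soloInformed_per_mem_span_iff_of_changeOfVariables` — in any dimension, sector membership is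
  transported along rule (2): `[E, (g ∘ Φ)·|det Φ'|]` is in the sector iff `[Φ(E), g]` is.
* `soloInformed_per_mem_span_of_jacobian_mul` — the weighted form: `[D, (g ∘ Φ)·|det Φ'|]` is in
  the sector as soon as `[Φ(D), g]` is a polynomially weighted bounded planar integral.

What the criterion does NOT reach (recorded obstruction, `paper/paper.md` §6novies): a weight is a
Nash Jacobian on `D` only if `[D, w]` is move-equivalent to a planar area, so its value is a
`ℤ`-combination of curve periods; weights such as `1/((1 + x²)(1 + y²))` on `[0, 1]²`
(value `π²/16`) are not expected to be of this form.

References: M. Kontsevich, D. Zagier, *Periods* (2001), §1.2, rule (2) [KontsevichZagier2001];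
J. Bochnak, M. Coste, M.-F. Roy, *Real algebraic geometry* (1998), §2.2 (semialgebraic maps)
[BochnakCosteRoy1998].
-/

noncomputable section

open MeasureTheory Set
open Literature.ModelTheory.ExponentialFields Literature.NumberTheory.Transcendental
open Literature.NumberTheory.Transcendental.KZ

namespace Summit.KontsevichZagierPeriods.KontsevichZagierPeriods.Theorems

/-- **Sector membership is transported along rule (2)** (any dimension): if `Φ` is an injective
`ℚ`-semialgebraic map differentiable within `r.domain`, `r'.domain = Φ(r.domain)` and
`r.integrand = (r'.integrand ∘ Φ)·|det Φ'|` on `r.domain`, then `Per r` is in the curve sector iff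
`Per r'` is. [Kontsevich–Zagier 2001, §1.2, rule (2)] -/
theorem soloInformed_per_mem_span_iff_of_changeOfVariables {n : ℕ} (r r' : IntegralRep n)
    (Φ : (Fin n → ℝ) → (Fin n → ℝ)) (Φ' : (Fin n → ℝ) → (Fin n → ℝ) →L[ℝ] (Fin n → ℝ))
    (hsa : IsSemialgebraicMapOn ℚ r.domain Φ)
    (hd : ∀ x ∈ r.domain, HasFDerivWithinAt Φ (Φ' x) r.domain x) (hinj : InjOn Φ r.domain)
    (hdom : r'.domain = Φ '' r.domain)
    (hr : ∀ x ∈ r.domain, r.integrand x = r'.integrand (Φ x) * |(Φ' x).det|) :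
    soloInformedPer r ∈ soloInformedKappaSpan ↔ soloInformedPer r' ∈ soloInformedKappaSpan := by
  have hrel : of r - of r' ∈ relations :=
    changeOfVariablesRel_subset_relations ⟨n, r, r', Φ, Φ', hsa, hd, hinj, hdom, hr, rfl⟩
  rw [soloInformedPer_congr hrel]

/-- **THEOREM XVI-J (Jacobian criterion).** Let `r = [D, w]` be a representation of dimension two
and `Φ` an injective `ℚ`-semialgebraic map on `D`, differentiable within `D` with derivative `Φ'`,
with bounded image, such that `w = |det Φ'|` on `D`. Then `Per r ∈ soloInformedKappaSpan`:
`[D, |det Φ'|] ≡ [Φ(D), 1]` by rule (2), and areas of bounded planar `ℚ`-semialgebraic sets are in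
the sector. [Kontsevich–Zagier 2001, §1.2, rule (2); Huber–Wüstholz 2022, §13.1] -/
theorem soloInformed_per_mem_span_of_jacobian (r : IntegralRep 2)
    (Φ : (Fin 2 → ℝ) → (Fin 2 → ℝ)) (Φ' : (Fin 2 → ℝ) → (Fin 2 → ℝ) →L[ℝ] (Fin 2 → ℝ))
    (hsa : IsSemialgebraicMapOn ℚ r.domain Φ)
    (hd : ∀ x ∈ r.domain, HasFDerivWithinAt Φ (Φ' x) r.domain x) (hinj : InjOn Φ r.domain)
    (hb : Bornology.IsBounded (Φ '' r.domain))
    (hr : ∀ x ∈ r.domain, r.integrand x = |(Φ' x).det|) :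
    soloInformedPer r ∈ soloInformedKappaSpan := by
  have hIm : IsSemialgebraic ℚ (Φ '' r.domain) :=
    IsSemialgebraicMapOn.isSemialgebraic_image_holds hsa Subset.rfl r.isSemialgebraic_domain
  let r' : IntegralRep 2 := ⟨Φ '' r.domain, fun _ => 1, hIm,
    by simpa using isSemialgebraicFunOn_ratCast hIm 1, integrableOn_const hb.measure_lt_top.ne⟩
  rw [soloInformed_per_mem_span_iff_of_changeOfVariables r r' Φ Φ' hsa hd hinj rfl
    fun x hx => by rw [hr x hx]; exact (one_mul _).symm]
  exact soloInformed_per_mem_span_planar_of_isBounded r' hb fun _ _ => rfl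

/-- **Weighted Jacobian criterion.** If `w = (p ∘ Φ)·|det Φ'|` on `D` for an injective
`ℚ`-semialgebraic `Φ` differentiable within `D` with bounded image and a polynomial `p ∈ ℚ[u, v]`,
then `Per [D, w]` is in the curve sector (rule (2) onto the polynomially weighted `[Φ(D), p]`,
Theorem XVI-P). [Kontsevich–Zagier 2001, §1.2, rule (2)] -/
theorem soloInformed_per_mem_span_of_jacobian_mul (r : IntegralRep 2)
    (Φ : (Fin 2 → ℝ) → (Fin 2 → ℝ)) (Φ' : (Fin 2 → ℝ) → (Fin 2 → ℝ) →L[ℝ] (Fin 2 → ℝ))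
    (hsa : IsSemialgebraicMapOn ℚ r.domain Φ)
    (hd : ∀ x ∈ r.domain, HasFDerivWithinAt Φ (Φ' x) r.domain x) (hinj : InjOn Φ r.domain)
    (hb : Bornology.IsBounded (Φ '' r.domain)) (p : MvPolynomial (Fin 2) ℚ)
    (hr : ∀ x ∈ r.domain, r.integrand x = MvPolynomial.aeval (Φ x) p * |(Φ' x).det|) :
    soloInformedPer r ∈ soloInformedKappaSpan := by
  have hIm : IsSemialgebraic ℚ (Φ '' r.domain) :=
    IsSemialgebraicMapOn.isSemialgebraic_image_holds hsa Subset.rfl r.isSemialgebraic_domain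
  obtain ⟨R, -, hR⟩ := soloInformed_exists_abs_le_of_isBounded hb
  let r' : IntegralRep 2 := ⟨Φ '' r.domain, fun u => (MvPolynomial.aeval u p : ℝ), hIm,
    isSemialgebraicFunOn_aeval hIm p,
    ((soloInformed_continuous_aeval_of_hasFDerivAt p).continuousOn.integrableOn_compact
      (soloInformed_isCompact_box (n := 2) R)).mono_set fun u hu => hR u hu⟩
  rw [soloInformed_per_mem_span_iff_of_changeOfVariables r r' Φ Φ' hsa hd hinj rfl
    fun x hx => by rw [hr x hx]]
  exact soloInformed_per_mem_span_poly r' hb p fun _ _ => rfl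

end Summit.KontsevichZagierPeriods.KontsevichZagierPeriods.Theorems
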